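import Literature.NumberTheory.Sieve.LinearEquationsInPrimesFlatOrthogonality
import HarnessLib

/-!
# Linear equations in primes: the metric class of a nilmanifold — `MN(1)` fails for a compatible
# metric on `ℝ/ℤ`; smoothly metrised nilmanifolds; Thm. 7.2 from the printed inputs
# (Green–Tao 2010, Def. 8.1, Conj. 8.3, Conj. 8.5, Thm. 7.2)

Trunk T-SIEVE (`Literature/NumberTheory/Sieve`), a file of the programme decomposing the named fact
`Literature.NumberTheory.Sieve.GreenTao2010_gowersUniformity` (B. Green, T. Tao, *Linear equations
in primes*, Ann. of Math. 171 (2010), Thm. 7.2) inline.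

The tree's structure `Nilmanifold s` (Def. 8.1 of the source) carries an *arbitrary* metric on `G/Γ`
inducing the quotient topology, whereas the source states its two conjectural inputs for smoothly
metrised nilmanifolds: `GI(s)` (Conj. 8.3) produces "a finite collection `ℳ_{s,δ}` of `s`-step
nilmanifolds `G/Γ = (G/Γ, d_{G/Γ})`", the metric being "some fixed smooth metric", and `MN(s)`
(Conj. 8.5) is stated for "an `s`-step nilmanifold with smooth metric `d_{G/Γ}`" (and proved, by
Green–Tao 2012, Thm. 1.1, for Mal'cev-basis metrics, bi-Lipschitz to any smooth Riemannian metric on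
the compact quotient). For `GI(s)`, existential in the metrised family, allowing more metrics only
weakens the statement; for `MN(s)`, universal over the `M`-Lipschitz class of the metric, it does
not. This file (i) constructs a compatible metric on `ℝ/ℤ` for which `MN(1)` fails, (ii) isolates
the intended metric class as a predicate `Nilmanifold.IsSmoothlyMetrised`, and (iii) records the
reduction of Thm. 7.2 with every nilmanifold-side hypothesis asked only of the members of the inverse
families — in particular from the *printed* `GI(s)` and `MN(s)` for smoothly metrised nilmanifolds.

**(i) The pathology** (namespace `MetricPathology`).
* `pathF N` — test functions `F_N = ε_N · clamp(G_N)` on `ℝ/ℤ`, `G_N(x) = ∑_{0<m<N} μ(m) Λ(N‖x - m/N‖)`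
  (signed tents of radius `1/(4N)` at the points `m/N`), `ε_N = 1/(log N + 2)`: `|F_N| ≤ ε_N`, `F_N` is
  `2N²`-Lipschitz for the usual metric (`abs_pathF_sub_le`), and
  `∑_{n ≤ N} μ(n) F_N(n/N) = ε_N ∑_{n<N} μ(n)²` (`sum_moebius_mul_pathF`, from the `1/N`-separation of
  the points `n/N`, `norm_coe_div_ge`);
* `sum_moebius_sq_ge` — `∑_{n ≤ M} μ(n)² = #{n ≤ M squarefree} ≥ M/4` (elementary: union bound over
  `d² ∣ n` and `∑_{d≥2} 1/d² ≤ 3/4`);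
* `pathDist` — the metric `d'(x,y) = ‖x - y‖ + sup_N |F_N(x) - F_N(y)|` on `ℝ/ℤ`; it induces the usual
  topology (`isOpen_iff_pathDist`; the family `(F_N)` is equicontinuous, `oscDist_le_of_norm_lt`), and
  every `F_N` is `1`-bounded and `1`-Lipschitz for `d'`;
* `badCircle : Nilmanifold 1` — the circle (`G = ℝ`, `Γ = ℤ`, as in `Nilmanifold.circle`) with the
  metric `d'`; it is rational and divisible (`badCircle_isRational`, `badCircle_isDivisible`);
* **`not_MNAt_badCircle : ¬ GreenTao2010_MNAt 1 badCircle 1`** — along the rotation by `1/N` from `0`,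
  `|∑_{n≤N} μ(n) F_N(gⁿx)| = ε_N ∑_{n<N} μ(n)² ≥ (N-1)/(4(log N + 2))`, which beats `C N / log² N` for
  `log N ≥ 8 max(C,1) + 4`; `exists_nilmanifold_not_MNAt` (every level `s ≥ 1`, via
  `Nilmanifold.ofLE`), **`not_forall_MNAt`**, `not_forall_levels_MNAt`:
  `¬ ∀ s ≥ 1, ∀ (Y : Nilmanifold s) M, GreenTao2010_MNAt s Y M`. Consequently the hypothesis `hMN`
  of the all-quantified assemblies `GreenTao2010_gowersUniformity_of_malcev_of_GI_of_MN_of_sharp` and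
  `GreenTaoZiegler2012_finiteComplexity_of_malcev_of_GI_of_MN_of_sharp`
  (`LinearEquationsInPrimesFlatOrthogonality.lean`) is unsatisfiable: those two theorems are vacuous
  as stated (the per-nilmanifold reduction `GreenTao2010_flatOrthogonalAt_of_MN` is not affected).

**(ii) The metric class** (namespace `Nilmanifold`).
* `Nilmanifold.IsSmoothlyMetrised X` — uniformly in the base point `yΓ`, the metric is bi-Lipschitz
  at small scales to the chart distance of the group acting on the left:
  `C⁻¹‖φ(u) - φ(1)‖ ≤ d(uyΓ, yΓ) ≤ C‖φ(u) - φ(1)‖` for `u` near `1` and all `y` (`φ` the chart of `G`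
  at `1`). Smooth Riemannian metrics on `G/Γ` and the Mal'cev-basis metrics of Green–Tao (2012) and
  Green–Tao–Ziegler (2012) satisfy it, and a compatible metric satisfying it is bi-Lipschitz to them
  on the compact quotient (docstring of the definition), so `GI(s)`/`MN(s)` read for this class are
  the printed conjectures;
* `isSmoothlyMetrised_circle`, `isSmoothlyMetrised_point`, `isSmoothlyMetrised_prod`,
  `isSmoothlyMetrised_pow`, `isSmoothlyMetrised_ofLE_iff`, `isSmoothlyMetrised_pow_prod_circle` (the
  nilmanifolds `X^m × ℝ/ℤ` of §12), and `MetricPathology.not_isSmoothlyMetrised_badCircle`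
  (`d'(0 + ℤ, 1/N + ℤ) ≥ ε_N ≫ 1/N`).

**(iii) Thm. 7.2 with the metric class explicit.**
* `GreenTao2010_gowersUniformityAt_of_datum_of_MN_of_sharp`, `…At_of_class_of_sharp` — level `s`
  from a `GI(s)` datum / a class `𝒞` containing the inverse families, with Lemma E.9, divisibility and
  `MN(s)` asked only of the members and their powers times `ℝ/ℤ`, plus (12.6);
* **`GreenTao2010_gowersUniformityAt_of_smooth_of_sharp`**,
  **`GreenTao2010_gowersUniformity_of_smooth_GI_of_MN_of_sharp`** — Thm. 7.2 (level `s`, all `s`)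
  from `GI(s)` with smoothly metrised families (as printed), Lemma E.9 + divisibility for smoothly
  metrised nilmanifolds, `MN(s)` for smoothly metrised nilmanifolds (as printed), and (12.6)
  (discharged in `LinearEquationsInPrimesSharpUniform.lean`).

All statements are theorems (no named facts); the pathology is folklore (equicontinuous
remetrisation of a compact metric space).

## References

* B. Green, T. Tao, *Linear equations in primes*, Ann. of Math. (2) 171 (2010), 1753–1850
  (arXiv:math/0606088): Def. 8.1, Conj. 8.3, Conj. 8.5 ("with smooth metric `d_{G/Γ}`"; "the implied
  constant is not allowed to depend on `g` and `x`"), Thm. 7.2, §§10–12.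
* B. Green, T. Tao, *The Möbius function is strongly orthogonal to nilsequences*, Ann. of Math. 175
  (2012), 541–566, Thm. 1.1 (`MN(s)` for Mal'cev-basis metrics).
* B. Green, T. Tao, T. Ziegler, *An inverse theorem for the Gowers `U^{s+1}[N]`-norm*, Ann. of Math.
  176 (2012), 1231–1372, Thm. 1.3 (`GI(s)`).
-/

noncomputable section

open Finset Filter Topology
open scoped BigOperators

namespace Literature.NumberTheory.Sieve

namespace MetricPathology

/-! ### Squarefree integers have density at least `1/4` (elementary) -/

/-- `∑_{2 ≤ d ≤ M} 1/d² ≤ 3/4 - 1/M` for `M ≥ 2` (compare `1/d² ≤ 1/(d-1) - 1/d` for `d ≥ 3`).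
[folklore] -/
theorem sum_inv_sq_le {M : ℕ} (hM : 2 ≤ M) :
    ∑ d ∈ Icc 2 M, (1 : ℝ) / ((d : ℝ) * d) ≤ 3 / 4 - 1 / M := by
  induction M, hM using Nat.le_induction with
  | base => norm_num
  | succ M hM ih =>
    rw [Finset.sum_Icc_succ_top (by omega), Nat.cast_succ]
    have hM0 : (0 : ℝ) < M := by exact_mod_cast (show 0 < M by omega)
    have hkey : (1 : ℝ) / ((M + 1) * (M + 1)) ≤ 1 / M - 1 / (M + 1) := by
      rw [div_sub_div _ _ hM0.ne' (by positivity), div_le_div_iff₀ (by positivity) (by positivity)]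
      nlinarith
    linarith

/-- `∑_{2 ≤ d ≤ M} 1/d² ≤ 3/4` for every `M`. [folklore] -/
theorem sum_inv_sq_le' (M : ℕ) : ∑ d ∈ Icc 2 M, (1 : ℝ) / ((d : ℝ) * d) ≤ 3 / 4 := by
  rcases lt_or_ge M 2 with hM | hM
  · rw [Finset.Icc_eq_empty_of_lt hM, Finset.sum_empty]; norm_num
  · exact (sum_inv_sq_le hM).trans (by
      have : (0 : ℝ) ≤ 1 / M := by positivity
      linarith)

/-- A non-squarefree `n ≥ 1` is divisible by `d²` for some `2 ≤ d ≤ n`. [folklore] -/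
theorem exists_sq_dvd_of_not_squarefree {n : ℕ} (hn : 1 ≤ n) (h : ¬Squarefree n) :
    ∃ d : ℕ, 2 ≤ d ∧ d ≤ n ∧ d * d ∣ n := by
  unfold Squarefree at h
  push Not at h
  obtain ⟨d, hd, hunit⟩ := h
  have hd0 : d ≠ 0 := by
    rintro rfl
    rw [zero_mul, zero_dvd_iff] at hd
    omega
  have hd1 : d ≠ 1 := fun h1 => hunit (h1 ▸ isUnit_one)
  refine ⟨d, by omega, ?_, hd⟩
  have h1 := Nat.le_of_dvd (by omega) hd
  nlinarith

/-- **At least a quarter of the integers in `[1, M]` are squarefree**: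
`#{n ≤ M squarefree} ≥ M/4` (union bound over `d² ∣ n`, `2 ≤ d ≤ M`, and `∑_{d ≥ 2} 1/d² ≤ 3/4`).
[folklore] -/
theorem card_squarefree_ge (M : ℕ) :
    (M : ℝ) / 4 ≤ (((Icc 1 M).filter Squarefree).card : ℝ) := by
  classical
  set S : Finset ℕ := Icc 1 M with hS
  have hcard : ((S.filter Squarefree).card : ℝ) + (S.filter fun n => ¬Squarefree n).card = M := by
    have h := Finset.card_filter_add_card_filter_not (s := S) (p := Squarefree)
    rw [hS, Nat.card_Icc] at h
    have h' : ((Finset.filter Squarefree (Icc 1 M)).card : ℝ) +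
        ((Finset.filter (fun n => ¬Squarefree n) (Icc 1 M)).card : ℝ) = ((M + 1 - 1 : ℕ) : ℝ) := by
      exact_mod_cast h
    simpa using h'
  -- union bound
  have hsub : (S.filter fun n => ¬Squarefree n) ⊆
      (Icc 2 M).biUnion fun d => S.filter fun n => d * d ∣ n := by
    intro n hn
    rw [Finset.mem_filter] at hn
    obtain ⟨hnS, hnsq⟩ := hn
    have hn1 : 1 ≤ n ∧ n ≤ M := by simpa [hS] using hnS
    obtain ⟨d, hd2, hdn, hdd⟩ := exists_sq_dvd_of_not_squarefree hn1.1 hnsq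
    rw [Finset.mem_biUnion]
    exact ⟨d, Finset.mem_Icc.2 ⟨hd2, hdn.trans hn1.2⟩, Finset.mem_filter.2 ⟨hnS, hdd⟩⟩
  have hbad : ((S.filter fun n => ¬Squarefree n).card : ℝ) ≤ 3 / 4 * M := by
    calc ((S.filter fun n => ¬Squarefree n).card : ℝ)
        ≤ (((Icc 2 M).biUnion fun d => S.filter fun n => d * d ∣ n).card : ℝ) := by
          exact_mod_cast Finset.card_le_card hsub
      _ ≤ ∑ d ∈ Icc 2 M, ((S.filter fun n => d * d ∣ n).card : ℝ) := by
          exact_mod_cast Finset.card_biUnion_le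
      _ ≤ ∑ d ∈ Icc 2 M, (M : ℝ) * (1 / ((d : ℝ) * d)) := by
          refine Finset.sum_le_sum fun d hd => ?_
          have hd2 : 2 ≤ d := (Finset.mem_Icc.1 hd).1
          have hSeq : S = Ioc 0 M := by
            ext n; simp [hS]; omega
          rw [hSeq, Nat.Ioc_filter_dvd_card_eq_div]
          calc ((M / (d * d) : ℕ) : ℝ) ≤ (M : ℝ) / ((d * d : ℕ) : ℝ) := Nat.cast_div_le
            _ = (M : ℝ) * (1 / ((d : ℝ) * d)) := by push_cast; ring
      _ = (M : ℝ) * ∑ d ∈ Icc 2 M, 1 / ((d : ℝ) * d) := by rw [Finset.mul_sum]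
      _ ≤ (M : ℝ) * (3 / 4) := mul_le_mul_of_nonneg_left (sum_inv_sq_le' M) (Nat.cast_nonneg M)
      _ = 3 / 4 * M := by ring
  linarith

/-- `∑_{n ≤ M} μ(n)² = #{n ≤ M squarefree} ≥ M/4`. [folklore] -/
theorem sum_moebius_sq_ge (M : ℕ) :
    (M : ℝ) / 4 ≤ ∑ n ∈ Icc 1 M, ((ArithmeticFunction.moebius n : ℝ)) ^ 2 := by
  classical
  have h : ∑ n ∈ Icc 1 M, ((ArithmeticFunction.moebius n : ℝ)) ^ 2 =
      (((Icc 1 M).filter Squarefree).card : ℝ) := by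
    rw [Finset.card_eq_sum_ones, Nat.cast_sum, Finset.sum_filter]
    refine Finset.sum_congr rfl fun n _ => ?_
    split_ifs with hn
    · have := ArithmeticFunction.moebius_sq_eq_one_of_squarefree hn
      push_cast
      exact_mod_cast this
    · rw [ArithmeticFunction.moebius_eq_zero_of_not_squarefree hn]; simp
  rw [h]
  exact card_squarefree_ge M

/-! ### The points `n/N` of `ℝ/ℤ` are `1/N`-separated -/

/-- For an integer `k` not divisible by `N`, the point `k/N` of `ℝ/ℤ` has norm `≥ 1/N`. [folklore] -/
theorem norm_coe_div_ge {N : ℕ} (hN : 0 < N) {k : ℤ} (hk : ¬((N : ℤ) ∣ k)) :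
    (1 : ℝ) / N ≤ ‖(((k : ℝ) / N : ℝ) : AddCircle (1 : ℝ))‖ := by
  rw [AddCircle.norm_eq, inv_one, one_mul, mul_one]
  set r : ℤ := round ((k : ℝ) / N) with hr
  have hN0 : (0 : ℝ) < N := Nat.cast_pos.2 hN
  have hrew : (k : ℝ) / N - r = ((k - r * N : ℤ) : ℝ) / N := by
    field_simp
    push_cast
    ring
  rw [hrew, abs_div, abs_of_pos hN0]
  refine div_le_div_of_nonneg_right ?_ hN0.le
  have hne : k - r * N ≠ 0 := fun h => hk ⟨r, by linarith⟩
  exact_mod_cast Int.one_le_abs hne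

end MetricPathology

end Literature.NumberTheory.Sieve

namespace Literature.NumberTheory.Sieve

namespace MetricPathology

/-! ### A family of small, increasingly oscillating test functions on `ℝ/ℤ` -/

/-- The tent `Λ(u) = max(1 - 4u, 0)`. [folklore] -/
def tent (u : ℝ) : ℝ := max (1 - 4 * u) 0

/-- `Λ(0) = 1`. [folklore] -/
theorem tent_zero : tent 0 = 1 := by simp [tent]

/-- `Λ(u) = 0` for `u ≥ 1/4`. [folklore] -/
theorem tent_eq_zero {u : ℝ} (hu : 1 / 4 ≤ u) : tent u = 0 := by
  unfold tent; exact max_eq_right (by linarith)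

/-- `Λ` is `4`-Lipschitz. [folklore] -/
theorem abs_tent_sub_tent_le (u v : ℝ) : |tent u - tent v| ≤ 4 * |u - v| := by
  unfold tent
  refine (abs_max_sub_max_le_abs _ _ _).trans (le_of_eq ?_)
  rw [show (1 - 4 * u) - (1 - 4 * v) = -(4 * (u - v)) by ring, abs_neg, abs_mul,
    abs_of_pos (by norm_num : (0 : ℝ) < 4)]

/-- The clamp to `[-1, 1]`. [folklore] -/
def clamp (a : ℝ) : ℝ := max (min a 1) (-1)

/-- `|clamp a| ≤ 1`. [folklore] -/
theorem abs_clamp_le (a : ℝ) : |clamp a| ≤ 1 := by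
  unfold clamp
  rw [abs_le]
  exact ⟨le_max_right _ _, max_le (min_le_right _ _) (by norm_num)⟩

/-- `clamp a = a` for `|a| ≤ 1`. [folklore] -/
theorem clamp_eq_self {a : ℝ} (h : |a| ≤ 1) : clamp a = a := by
  rw [abs_le] at h
  unfold clamp
  rw [min_eq_left h.2, max_eq_left h.1]

/-- The clamp is `1`-Lipschitz. [folklore] -/
theorem abs_clamp_sub_clamp_le (a b : ℝ) : |clamp a - clamp b| ≤ |a - b| := by
  unfold clamp
  refine (abs_max_sub_max_le_abs _ _ _).trans ?_
  refine (abs_min_sub_min_le_max _ _ _ _).trans ?_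
  rw [sub_self, abs_zero]
  exact max_le le_rfl (abs_nonneg _)

/-- The point `r + ℤ` of `ℝ/ℤ = AddCircle 1`. [folklore] -/
def pt (r : ℝ) : AddCircle (1 : ℝ) := (r : AddCircle (1 : ℝ))

/-- The signed bump sum `G_N(x) = ∑_{0 < m < N} μ(m) Λ(N ‖x - m/N‖)` on `ℝ/ℤ`: a bump of height
`μ(m)` and radius `1/(4N)` at each point `m/N`, `0 < m < N`. [folklore] -/
def bumpSum (N : ℕ) (x : AddCircle (1 : ℝ)) : ℝ :=
  ∑ m ∈ Icc 1 (N - 1), (ArithmeticFunction.moebius m : ℝ) * tent (N * ‖x - pt ((m : ℝ) / N)‖)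

/-- The amplitudes `ε_N = 1/(log N + 2) → 0`. [folklore] -/
def eps (N : ℕ) : ℝ := 1 / (Real.log N + 2)

/-- `ε_N > 0`. [folklore] -/
theorem eps_pos (N : ℕ) : 0 < eps N := by
  unfold eps; have := Real.log_natCast_nonneg N; positivity

/-- `ε_N ≤ 1/2`. [folklore] -/
theorem eps_le_half (N : ℕ) : eps N ≤ 1 / 2 := by
  unfold eps
  have := Real.log_natCast_nonneg N
  rw [div_le_div_iff₀ (by positivity) (by norm_num)]
  linarith

/-- `ε_N` is non-increasing in `N`. [folklore] -/
theorem eps_antitone {N N' : ℕ} (h : N ≤ N') : eps N' ≤ eps N := by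
  unfold eps
  rcases Nat.eq_zero_or_pos N with rfl | hN
  · have := Real.log_natCast_nonneg N'
    simp only [Nat.cast_zero, Real.log_zero, zero_add]
    rw [div_le_div_iff₀ (by positivity) (by norm_num)]
    linarith
  · have hlog : Real.log N ≤ Real.log N' :=
      Real.log_le_log (Nat.cast_pos.2 hN) (by exact_mod_cast h)
    have := Real.log_natCast_nonneg N
    exact one_div_le_one_div_of_le (by positivity) (by linarith)

/-- `ε_N ≤ 1/(t + 2)` whenever `exp t ≤ N` (`t ≥ 0`). [folklore] -/
theorem eps_le_of_exp_le {t : ℝ} (ht0 : 0 ≤ t) {N : ℕ} (hN : Real.exp t ≤ N) : eps N ≤ 1 / (t + 2) := by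
  unfold eps
  have hNpos : (0 : ℝ) < N := (Real.exp_pos t).trans_le hN
  have ht : t ≤ Real.log N := (Real.le_log_iff_exp_le hNpos).2 hN
  exact one_div_le_one_div_of_le (by positivity) (by linarith)

/-- The test functions `F_N = ε_N · clamp(G_N)` on `ℝ/ℤ`. [folklore] -/
def pathF (N : ℕ) (x : AddCircle (1 : ℝ)) : ℝ := eps N * clamp (bumpSum N x)

/-- `|F_N| ≤ ε_N`. [folklore] -/
theorem abs_pathF_le (N : ℕ) (x : AddCircle (1 : ℝ)) : |pathF N x| ≤ eps N := by
  unfold pathF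
  rw [abs_mul, abs_of_pos (eps_pos N)]
  exact mul_le_of_le_one_right (eps_pos N).le (abs_clamp_le _)

/-- `|F_N| ≤ 1`. [folklore] -/
theorem abs_pathF_le_one (N : ℕ) (x : AddCircle (1 : ℝ)) : |pathF N x| ≤ 1 :=
  (abs_pathF_le N x).trans ((eps_le_half N).trans (by norm_num))

/-- `|F_N(x) - F_N(y)| ≤ 2 ε_N`. [folklore] -/
theorem abs_pathF_sub_le_two_eps (N : ℕ) (x y : AddCircle (1 : ℝ)) :
    |pathF N x - pathF N y| ≤ 2 * eps N := by
  have h := abs_sub _ _ |>.trans (add_le_add (abs_pathF_le N x) (abs_pathF_le N y))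
  linarith

/-- The bump sum is `4N(N-1)`-Lipschitz for the metric of `ℝ/ℤ`. [folklore] -/
theorem abs_bumpSum_sub_le (N : ℕ) (x y : AddCircle (1 : ℝ)) :
    |bumpSum N x - bumpSum N y| ≤ 4 * N * (N - 1 : ℕ) * ‖x - y‖ := by
  unfold bumpSum
  rw [← Finset.sum_sub_distrib]
  refine (Finset.abs_sum_le_sum_abs _ _).trans ?_
  have hterm : ∀ m ∈ Icc 1 (N - 1),
      |(ArithmeticFunction.moebius m : ℝ) * tent (N * ‖x - pt ((m : ℝ) / N)‖) -
          (ArithmeticFunction.moebius m : ℝ) * tent (N * ‖y - pt ((m : ℝ) / N)‖)| ≤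
        4 * N * ‖x - y‖ := by
    intro m _
    rw [← mul_sub, abs_mul]
    have hμ : |(ArithmeticFunction.moebius m : ℝ)| ≤ 1 := by
      exact_mod_cast ArithmeticFunction.abs_moebius_le_one
    have ht := abs_tent_sub_tent_le (N * ‖x - pt ((m : ℝ) / N)‖) (N * ‖y - pt ((m : ℝ) / N)‖)
    have hn : |(N : ℝ) * ‖x - pt ((m : ℝ) / N)‖ - N * ‖y - pt ((m : ℝ) / N)‖| ≤ N * ‖x - y‖ := by
      rw [← mul_sub, abs_mul, abs_of_nonneg (Nat.cast_nonneg N)]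
      refine mul_le_mul_of_nonneg_left ?_ (Nat.cast_nonneg N)
      have := abs_norm_sub_norm_le (x - pt ((m : ℝ) / N)) (y - pt ((m : ℝ) / N))
      rwa [sub_sub_sub_cancel_right] at this
    calc |(ArithmeticFunction.moebius m : ℝ)| *
          |tent (N * ‖x - pt ((m : ℝ) / N)‖) - tent (N * ‖y - pt ((m : ℝ) / N)‖)|
        ≤ 1 * (4 * (N * ‖x - y‖)) :=
          mul_le_mul hμ (ht.trans (by linarith)) (abs_nonneg _) zero_le_one
      _ = 4 * N * ‖x - y‖ := by ring
  refine (Finset.sum_le_sum hterm).trans (le_of_eq ?_)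
  rw [Finset.sum_const, Nat.card_Icc, nsmul_eq_mul]
  have : (N - 1 + 1 - 1 : ℕ) = N - 1 := by omega
  rw [this]; ring

/-- `F_N` is `2N²`-Lipschitz for the metric of `ℝ/ℤ`. [folklore] -/
theorem abs_pathF_sub_le (N : ℕ) (x y : AddCircle (1 : ℝ)) :
    |pathF N x - pathF N y| ≤ 2 * (N : ℝ) ^ 2 * ‖x - y‖ := by
  unfold pathF
  rw [← mul_sub, abs_mul, abs_of_pos (eps_pos N)]
  have h1 := (abs_clamp_sub_clamp_le (bumpSum N x) (bumpSum N y)).trans (abs_bumpSum_sub_le N x y)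
  have hN1 : ((N - 1 : ℕ) : ℝ) ≤ N := by exact_mod_cast Nat.sub_le N 1
  have hnn : 0 ≤ ‖x - y‖ := norm_nonneg _
  calc eps N * |clamp (bumpSum N x) - clamp (bumpSum N y)|
      ≤ (1 / 2) * (4 * N * (N - 1 : ℕ) * ‖x - y‖) :=
        mul_le_mul (eps_le_half N) h1 (abs_nonneg _) (by norm_num)
    _ ≤ (1 / 2) * (4 * N * N * ‖x - y‖) := by gcongr
    _ = 2 * (N : ℝ) ^ 2 * ‖x - y‖ := by ring

/-! ### The values of `F_N` along the rotation by `1/N` -/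

/-- `G_N(n/N) = μ(n)` for `0 < n < N` and `G_N(N/N) = G_N(0) = 0`: the bumps at the points `m/N`,
`0 < m < N`, `m ≠ n`, vanish at `n/N` since `‖(n-m)/N‖_{ℝ/ℤ} ≥ 1/N`. [folklore] -/
theorem bumpSum_pt {N n : ℕ} (hN : 0 < N) (hn1 : 1 ≤ n) (hnN : n ≤ N) :
    bumpSum N (pt ((n : ℝ) / N)) = if n ≤ N - 1 then (ArithmeticFunction.moebius n : ℝ) else 0 := by
  classical
  unfold bumpSum
  have hval : ∀ m ∈ Icc 1 (N - 1),
      (ArithmeticFunction.moebius m : ℝ) * tent (N * ‖pt ((n : ℝ) / N) - pt ((m : ℝ) / N)‖) =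
        if n = m then (ArithmeticFunction.moebius n : ℝ) else 0 := by
    intro m hm
    rw [Finset.mem_Icc] at hm
    split_ifs with hnm
    · subst hnm; rw [sub_self, norm_zero, mul_zero, tent_zero, mul_one]
    · rw [tent_eq_zero, mul_zero]
      have hsub : pt ((n : ℝ) / N) - pt ((m : ℝ) / N) = pt ((((n : ℤ) - m : ℤ) : ℝ) / N) := by
        unfold pt; rw [← AddCircle.coe_sub]; push_cast; ring_nf
      rw [hsub]
      have hndvd : ¬((N : ℤ) ∣ ((n : ℤ) - m)) := by
        rintro ⟨c, hc⟩
        have h1 : ((n : ℤ) - m) < N := by omega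
        have h2 : -(N : ℤ) < (n : ℤ) - m := by omega
        have hc0 : c = 0 := by
          rcases lt_trichotomy c 0 with hc' | hc' | hc'
          · nlinarith
          · exact hc'
          · nlinarith
        rw [hc0, mul_zero, sub_eq_zero] at hc
        exact hnm (by exact_mod_cast hc)
      have hsep := norm_coe_div_ge hN hndvd
      unfold pt at hsep ⊢
      have hN0 : (0 : ℝ) < N := Nat.cast_pos.2 hN
      calc (1 : ℝ) / 4 ≤ 1 := by norm_num
        _ = N * (1 / N) := by field_simp
        _ ≤ N * ‖(((((n : ℤ) - m : ℤ) : ℝ) / N : ℝ) : AddCircle (1 : ℝ))‖ :=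
            mul_le_mul_of_nonneg_left hsep hN0.le
  rw [Finset.sum_congr rfl hval, Finset.sum_ite_eq]
  simp only [Finset.mem_Icc]
  by_cases h : n ≤ N - 1
  · rw [if_pos ⟨hn1, h⟩, if_pos h]
  · rw [if_neg (fun h' => h h'.2), if_neg h]

/-- **The correlation of `F_N` with `μ` along the rotation by `1/N`**:
`∑_{n ≤ N} μ(n) F_N(n/N) = ε_N ∑_{n < N} μ(n)²`. [folklore] -/
theorem sum_moebius_mul_pathF {N : ℕ} (hN : 0 < N) :
    ∑ n ∈ Icc 1 N, (ArithmeticFunction.moebius n : ℝ) * pathF N (pt ((n : ℝ) / N)) =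
      eps N * ∑ n ∈ Icc 1 (N - 1), ((ArithmeticFunction.moebius n : ℝ)) ^ 2 := by
  have hstep : ∀ n ∈ Icc 1 N, (ArithmeticFunction.moebius n : ℝ) * pathF N (pt ((n : ℝ) / N)) =
      if n ≤ N - 1 then eps N * ((ArithmeticFunction.moebius n : ℝ)) ^ 2 else 0 := by
    intro n hn
    rw [Finset.mem_Icc] at hn
    unfold pathF
    rw [bumpSum_pt hN hn.1 hn.2]
    split_ifs with h
    · rw [clamp_eq_self (by exact_mod_cast ArithmeticFunction.abs_moebius_le_one)]; ring
    · simp [clamp]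
  rw [Finset.sum_congr rfl hstep]
  obtain ⟨M, rfl⟩ : ∃ M, N = M + 1 := ⟨N - 1, by omega⟩
  rw [Finset.sum_Icc_succ_top (by omega), if_neg (by omega), add_zero, Nat.add_sub_cancel,
    Finset.mul_sum]
  refine Finset.sum_congr rfl fun n hn => ?_
  rw [Finset.mem_Icc] at hn
  rw [if_pos hn.2]

end MetricPathology

end Literature.NumberTheory.Sieve

namespace Literature.NumberTheory.Sieve

namespace MetricPathology

/-! ### The compatible metric `d'(x,y) = ‖x - y‖ + sup_N |F_N(x) - F_N(y)|` on `ℝ/ℤ` -/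

/-- The oscillation pseudometric `sup_N |F_N(x) - F_N(y)|`. [folklore] -/
def oscDist (x y : AddCircle (1 : ℝ)) : ℝ := ⨆ N : ℕ, |pathF N x - pathF N y|

/-- The family `|F_N(x) - F_N(y)|` is bounded (by `1`). [folklore] -/
theorem bddAbove_osc (x y : AddCircle (1 : ℝ)) :
    BddAbove (Set.range fun N : ℕ => |pathF N x - pathF N y|) := by
  refine ⟨1, ?_⟩
  rintro _ ⟨N, rfl⟩
  exact (abs_pathF_sub_le_two_eps N x y).trans (by linarith [eps_le_half N])

/-- Each `F_N` is `1`-Lipschitz for the oscillation pseudometric. [folklore] -/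
theorem abs_sub_le_oscDist (N : ℕ) (x y : AddCircle (1 : ℝ)) :
    |pathF N x - pathF N y| ≤ oscDist x y :=
  le_ciSup (bddAbove_osc x y) N

/-- `oscDist ≥ 0`. [folklore] -/
theorem oscDist_nonneg (x y : AddCircle (1 : ℝ)) : 0 ≤ oscDist x y :=
  Real.iSup_nonneg fun _ => abs_nonneg _

/-- `oscDist x x = 0`. [folklore] -/
theorem oscDist_self (x : AddCircle (1 : ℝ)) : oscDist x x = 0 := by
  simp [oscDist]

/-- `oscDist` is symmetric. [folklore] -/
theorem oscDist_comm (x y : AddCircle (1 : ℝ)) : oscDist x y = oscDist y x := by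
  simp [oscDist, abs_sub_comm]

/-- `oscDist` satisfies the triangle inequality. [folklore] -/
theorem oscDist_triangle (x y z : AddCircle (1 : ℝ)) : oscDist x z ≤ oscDist x y + oscDist y z :=
  ciSup_le fun N =>
    (abs_sub_le _ _ _).trans (add_le_add (abs_sub_le_oscDist N x y) (abs_sub_le_oscDist N y z))

/-- **Equicontinuity of the family `(F_N)`**: `oscDist x y ≤ ε/2` as soon as `‖x - y‖ < δ(ε)`
(the finitely many `F_N` with `2ε_N > ε/2` are uniformly Lipschitz, the others are uniformly
small). [folklore] -/
theorem oscDist_le_of_norm_lt {ε : ℝ} (hε : 0 < ε) :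
    ∃ δ : ℝ, 0 < δ ∧ ∀ x y : AddCircle (1 : ℝ), ‖x - y‖ < δ → oscDist x y ≤ ε / 2 := by
  set N₀ : ℕ := ⌈Real.exp (4 / ε)⌉₊ with hN₀
  have hN₀exp : Real.exp (4 / ε) ≤ N₀ := Nat.le_ceil _
  refine ⟨ε / (4 * (N₀ : ℝ) ^ 2 + 4), by positivity, fun x y hxy => ciSup_le fun N => ?_⟩
  rcases le_or_gt N₀ N with hN | hN
  · -- large `N`: `2 ε_N ≤ ε/2`
    have hexpN : Real.exp (4 / ε) ≤ N := hN₀exp.trans (by exact_mod_cast hN)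
    have h1 := eps_le_of_exp_le (by positivity : (0 : ℝ) ≤ 4 / ε) hexpN
    have h2 : (1 : ℝ) / (4 / ε + 2) ≤ ε / 4 := by
      rw [div_le_div_iff₀ (by positivity) (by positivity)]
      have : ε * (4 / ε + 2) = 4 + 2 * ε := by field_simp
      nlinarith
    linarith [abs_pathF_sub_le_two_eps N x y]
  · -- small `N`: uniformly Lipschitz
    have hNN₀ : (N : ℝ) ≤ N₀ := by exact_mod_cast hN.le
    have hlip := abs_pathF_sub_le N x y
    have hnn : 0 ≤ ‖x - y‖ := norm_nonneg _
    have hN0 : (0 : ℝ) ≤ N := Nat.cast_nonneg N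
    calc |pathF N x - pathF N y| ≤ 2 * (N : ℝ) ^ 2 * ‖x - y‖ := hlip
      _ ≤ 2 * (N₀ : ℝ) ^ 2 * (ε / (4 * (N₀ : ℝ) ^ 2 + 4)) := by gcongr
      _ ≤ ε / 2 := by
          rw [mul_div_assoc', div_le_div_iff₀ (by positivity) (by norm_num)]
          nlinarith [sq_nonneg (N₀ : ℝ)]

/-- The new metric `d'(x, y) = ‖x - y‖ + sup_N |F_N(x) - F_N(y)|` on `ℝ/ℤ`. [folklore] -/
def pathDist (x y : AddCircle (1 : ℝ)) : ℝ := ‖x - y‖ + oscDist x y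

/-- `d'` dominates the usual metric. [folklore] -/
theorem norm_sub_le_pathDist (x y : AddCircle (1 : ℝ)) : ‖x - y‖ ≤ pathDist x y :=
  le_add_of_nonneg_right (oscDist_nonneg x y)

/-- **`d'` induces the topology of `ℝ/ℤ`**: `‖x - y‖ ≤ d'(x,y)`, and `d'(x,y) < ε` as soon as
`‖x - y‖ < δ(ε)` (equicontinuity). [folklore] -/
theorem isOpen_iff_pathDist (U : Set (AddCircle (1 : ℝ))) :
    IsOpen U ↔ ∀ x ∈ U, ∃ ε : ℝ, 0 < ε ∧ ∀ y, pathDist x y < ε → y ∈ U := by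
  rw [Metric.isOpen_iff]
  constructor
  · intro h x hx
    obtain ⟨ε, hε, hball⟩ := h x hx
    refine ⟨ε, hε, fun y hy => hball ?_⟩
    rw [Metric.mem_ball, dist_eq_norm, norm_sub_rev]
    exact (norm_sub_le_pathDist x y).trans_lt hy
  · intro h x hx
    obtain ⟨ε, hε, hb⟩ := h x hx
    obtain ⟨δ, hδ, hmod⟩ := oscDist_le_of_norm_lt hε
    refine ⟨min δ (ε / 2), by positivity, fun y hy => hb y ?_⟩
    rw [Metric.mem_ball, dist_eq_norm, norm_sub_rev] at hy
    have h1 := hmod x y (lt_of_lt_of_le hy (min_le_left _ _))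
    have h2 := lt_of_lt_of_le hy (min_le_right _ _)
    unfold pathDist
    linarith

/-- `d'(x, x) = 0`. [folklore] -/
theorem pathDist_self (x : AddCircle (1 : ℝ)) : pathDist x x = 0 := by
  unfold pathDist; rw [sub_self, norm_zero, oscDist_self, add_zero]

/-- `d'` is symmetric. [folklore] -/
theorem pathDist_comm (x y : AddCircle (1 : ℝ)) : pathDist x y = pathDist y x := by
  unfold pathDist; rw [norm_sub_rev, oscDist_comm]

/-- `d'` satisfies the triangle inequality. [folklore] -/
theorem pathDist_triangle (x y z : AddCircle (1 : ℝ)) : pathDist x z ≤ pathDist x y + pathDist y z := by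
  unfold pathDist
  have h1 := norm_sub_le_norm_sub_add_norm_sub x y z
  have h2 := oscDist_triangle x y z
  linarith

/-- `d'(x, y) = 0` only if `x = y`. [folklore] -/
theorem eq_of_pathDist_eq_zero {x y : AddCircle (1 : ℝ)} (h : pathDist x y = 0) : x = y := by
  unfold pathDist at h
  have h1 := oscDist_nonneg x y
  have h2 : ‖x - y‖ = 0 := le_antisymm (by linarith) (norm_nonneg _)
  exact sub_eq_zero.1 (norm_eq_zero.1 h2)

/-- **The circle `ℝ/ℤ` with the compatible metric `d'`** as a `1`-step nilmanifold in the sense of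
the tree's `Nilmanifold` structure (same Lie group `ℝ`, lattice `ℤ` and quotient topology as
`Nilmanifold.circle`; only the metric differs). [folklore] -/
def badCircle : Nilmanifold 1 :=
  { Nilmanifold.circle with
    dist := fun x y => pathDist x y
    dist_self := fun x => pathDist_self x
    dist_comm := fun x y => pathDist_comm x y
    dist_triangle := fun x y z => pathDist_triangle x y z
    eq_of_dist_eq_zero := fun _ _ h => eq_of_pathDist_eq_zero h
    isOpen_iff := fun U => by
      change IsOpen (X := AddCircle (1 : ℝ)) U ↔ _
      exact isOpen_iff_pathDist U }

/-- The metric of `badCircle` is `d'` (by construction). [folklore] -/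
theorem badCircle_dist_eq (x y : badCircle.G ⧸ badCircle.Γ) :
    badCircle.dist x y = pathDist x y := rfl

/-! ### `MN(1)` fails on `badCircle` -/

/-- The rotation by `1/N`, as an element of the Lie group `ℝ` of `badCircle`. [folklore] -/
def rot (N : ℕ) : badCircle.G := Multiplicative.ofAdd ((1 : ℝ) / (N : ℝ))

/-- The base point `0 + ℤ` of `badCircle`. [folklore] -/
def basePt : badCircle.G ⧸ badCircle.Γ := circlePt 0

/-- `F_N` read on `badCircle` (whose points are those of `ℝ/ℤ`). [folklore] -/
def testF (N : ℕ) : badCircle.G ⧸ badCircle.Γ → ℝ := fun y => pathF N y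

/-- The orbit of `0 + ℤ` under the rotation by `1/N`, read by `F_N`: `F_N(gⁿ · 0) = F_N(n/N)`.
[folklore] -/
theorem testF_orbit (N n : ℕ) : testF N (rot N ^ n • basePt) = pathF N (pt ((n : ℝ) / N)) := by
  change Nilmanifold.circle.nilsequence (fun y => pathF N y) (Multiplicative.ofAdd ((1 : ℝ) / (N : ℝ)))
    (QuotientGroup.mk (Multiplicative.ofAdd (0 : ℝ))) n = _
  rw [Nilmanifold.nilsequence_circle, zero_add, mul_one_div]
  rfl

/-- **Each `F_N` is a `1`-bounded, `1`-Lipschitz function on `badCircle`.** [folklore] -/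
theorem isBoundedLipschitz_testF (N : ℕ) : badCircle.IsBoundedLipschitz 1 (testF N) := by
  refine ⟨fun y => abs_pathF_le_one N _, fun y z => ?_⟩
  rw [one_mul, badCircle_dist_eq]
  exact (abs_sub_le_oscDist N _ _).trans (le_add_of_nonneg_left (norm_nonneg _))

/-- **The Möbius–nilsequences conjecture `MN(1)` fails for the compatibly (but not smoothly)
metrised circle `badCircle`**: for every `C` there is `N ≥ 2` with
`|∑_{n ≤ N} μ(n) F_N(n/N)| = ε_N ∑_{n<N} μ(n)² ≥ (N-1)/(4(log N + 2)) > C N / log² N`, although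
`F_N` is `1`-bounded and `1`-Lipschitz for `d'`. Hence the metric class in Conj. 8.5 ("smooth
Riemannian metric") cannot be relaxed to arbitrary compatible metrics, and a hypothesis "`MN(s)` for
every `Y : Nilmanifold s`" is unsatisfiable. (compare Green–Tao 2010, Conj. 8.5) [folklore] -/
theorem not_MNAt_badCircle : ¬GreenTao2010_MNAt 1 badCircle 1 := by
  intro h
  obtain ⟨C, hC⟩ := h 2 two_pos
  set C' : ℝ := max C 1 with hC'
  have hC'1 : 1 ≤ C' := le_max_right _ _
  have hCC' : C ≤ C' := le_max_left _ _
  set t : ℝ := 8 * C' + 4 with ht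
  set N : ℕ := ⌈Real.exp t⌉₊ with hNdef
  have hNexp : Real.exp t ≤ N := Nat.le_ceil _
  have hN13 : (13 : ℝ) ≤ N := le_trans (by linarith [Real.add_one_le_exp t]) hNexp
  have hN2 : 2 ≤ N := by exact_mod_cast (show (2 : ℝ) ≤ N by linarith)
  have hNpos : 0 < N := by omega
  have hN0 : (0 : ℝ) < N := Nat.cast_pos.2 hNpos
  have hlog : t ≤ Real.log N := (Real.le_log_iff_exp_le hN0).2 hNexp
  -- apply `MN(1)` on `badCircle` to `F_N` along the rotation by `1/N`
  have key := hC N hN2 (rot N) basePt (testF N) (isBoundedLipschitz_testF N)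
  have hsum : ∑ n ∈ Icc 1 N, (ArithmeticFunction.moebius n : ℝ) * testF N (rot N ^ n • basePt) =
      eps N * ∑ n ∈ Icc 1 (N - 1), ((ArithmeticFunction.moebius n : ℝ)) ^ 2 := by
    rw [← sum_moebius_mul_pathF hNpos]
    refine Finset.sum_congr rfl fun n _ => ?_
    rw [testF_orbit]
  rw [hsum] at key
  -- lower bound for the correlation
  have hQ := sum_moebius_sq_ge (N - 1)
  have hS0 : 0 ≤ ∑ n ∈ Icc 1 (N - 1), ((ArithmeticFunction.moebius n : ℝ)) ^ 2 :=
    Finset.sum_nonneg fun n _ => sq_nonneg _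
  have hcast : ((N - 1 : ℕ) : ℝ) = N - 1 := by
    rw [Nat.cast_sub (by omega), Nat.cast_one]
  rw [hcast] at hQ
  rw [abs_of_nonneg (mul_nonneg (eps_pos N).le hS0)] at key
  -- upper bound from `key`, with `C ≤ C'`
  have hL0 : 0 < Real.log N := by linarith
  have hrpow : Real.log N ^ (2 : ℝ) = Real.log N ^ 2 := Real.rpow_two _
  rw [hrpow] at key
  have key' : eps N * ((N - 1) / 4) ≤ C' * N / Real.log N ^ 2 := by
    calc eps N * ((N - 1) / 4) ≤ eps N * ∑ n ∈ Icc 1 (N - 1), ((ArithmeticFunction.moebius n : ℝ)) ^ 2 :=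
          mul_le_mul_of_nonneg_left hQ (eps_pos N).le
      _ ≤ C * N / Real.log N ^ 2 := key
      _ ≤ C' * N / Real.log N ^ 2 := by gcongr
  -- the final numerical contradiction: `L² ≤ 8 C'(L + 2)` is impossible for `L ≥ 8C' + 4`
  set L : ℝ := Real.log N with hL
  have hε : eps N = 1 / (L + 2) := rfl
  rw [hε] at key'
  have h1 : (N - 1) / 4 * L ^ 2 ≤ C' * N * (L + 2) := by
    have hL2 : 0 < L + 2 := by linarith
    have hL2' : 0 < L ^ 2 := by positivity
    have e1 : 1 / (L + 2) * (((N : ℝ) - 1) / 4) = ((N - 1) / 4) / (L + 2) := by ring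
    rw [e1, div_le_div_iff₀ hL2 hL2'] at key'
    linarith
  have h2 : (N : ℝ) / 2 ≤ N - 1 := by linarith
  have h3 : (N : ℝ) / 8 * L ^ 2 ≤ C' * N * (L + 2) := by nlinarith [sq_nonneg L]
  have h4 : L ^ 2 ≤ 8 * C' * (L + 2) := by
    have h3' : (N : ℝ) * (L ^ 2 / 8) ≤ N * (C' * (L + 2)) := by linarith
    have := le_of_mul_le_mul_left h3' hN0
    linarith
  have h5 : (8 * C' + 4) * L ≤ L ^ 2 := by
    rw [sq]; exact mul_le_mul_of_nonneg_right (ht ▸ hlog) hL0.le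
  linarith

end MetricPathology

end Literature.NumberTheory.Sieve

namespace Literature.NumberTheory.Sieve

namespace MetricPathology

/-! ### Consequences -/

/-- `badCircle` satisfies the rationality hypothesis (Lemma E.9; automatic in step `≤ 1`).
[folklore] -/
theorem badCircle_isRational : badCircle.IsRational := badCircle.isRational_of_le_one le_rfl

/-- `badCircle` satisfies the divisibility hypothesis (its Lie group is `ℝ`). [folklore] -/
theorem badCircle_isDivisible : badCircle.IsDivisible := Nilmanifold.isDivisible_circle

/-- Raising the step does not change rationality (it concerns `G`, `Γ` and the lower central
series only). [folklore] -/
theorem _root_.Literature.NumberTheory.Sieve.Nilmanifold.isRational_ofLE_iff {s s' : ℕ}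
    (X : Nilmanifold s) (h : s ≤ s') : (X.ofLE h).IsRational ↔ X.IsRational := Iff.rfl

/-- Raising the step does not change the `MN(s)` statement of a nilmanifold. [folklore] -/
theorem MNAt_ofLE_iff {s s' : ℕ} (Y : Nilmanifold s) (h : s ≤ s') (M : ℝ) :
    GreenTao2010_MNAt s' (Y.ofLE h) M ↔ GreenTao2010_MNAt s Y M := Iff.rfl

/-- **For every `s ≥ 1` there is an `s`-step nilmanifold (in the sense of the tree's `Nilmanifold`
structure: arbitrary compatible metric), rational and divisible, on which `MN(s)` fails at
Lipschitz constant `1`.** (compare Green–Tao 2010, Conj. 8.5) [folklore] -/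
theorem exists_nilmanifold_not_MNAt {s : ℕ} (hs : 1 ≤ s) :
    ∃ Y : Nilmanifold s, Y.IsRational ∧ Y.IsDivisible ∧ ¬GreenTao2010_MNAt s Y 1 :=
  ⟨badCircle.ofLE hs, (Nilmanifold.isRational_ofLE_iff badCircle hs).2 badCircle_isRational,
    Nilmanifold.isDivisible_ofLE badCircle hs badCircle_isDivisible,
    (MNAt_ofLE_iff badCircle hs 1).not.2 not_MNAt_badCircle⟩

/-- **The hypothesis "`MN(s)` for every `Y : Nilmanifold s`" is false at every level `s ≥ 1`** — so
the all-quantified assemblies `GreenTao2010_gowersUniformity_of_malcev_of_GI_of_MN_of_sharp` and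
`GreenTaoZiegler2012_finiteComplexity_of_malcev_of_GI_of_MN_of_sharp` have an unsatisfiable
hypothesis, and the class-relativised assemblies (hypotheses asked only of the smoothly metrised
members of the inverse families) are the ones that the printed `MN(s)` can feed.
(compare Green–Tao 2010, Conj. 8.5) [folklore] -/
theorem not_forall_MNAt {s : ℕ} (hs : 1 ≤ s) : ¬∀ (Y : Nilmanifold s) (M : ℝ), GreenTao2010_MNAt s Y M := by
  intro h
  obtain ⟨Y, -, -, hY⟩ := exists_nilmanifold_not_MNAt hs
  exact hY (h Y 1)

/-- The all-levels form: `¬ ∀ s ≥ 1, ∀ Y M, MN(s)_{Y,M}`. (compare Green–Tao 2010, Conj. 8.5) [folklore] -/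
theorem not_forall_levels_MNAt :
    ¬∀ s : ℕ, 1 ≤ s → ∀ (Y : Nilmanifold s) (M : ℝ), GreenTao2010_MNAt s Y M :=
  fun h => not_forall_MNAt le_rfl (h 1 le_rfl)

end MetricPathology

end Literature.NumberTheory.Sieve

namespace Literature.NumberTheory.Sieve

namespace Nilmanifold

open scoped Manifold

variable {s : ℕ}

/-! ### Smoothly metrised nilmanifolds (the metric class of Conj. 8.3 and Conj. 8.5) -/

/-- **Smoothly metrised nilmanifolds.** The metric `d_{G/Γ}` of `X` is *smoothly compatible* if,
uniformly in the base point `yΓ`, it is bi-Lipschitz at small scales to the chart distance of the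
Lie group acting from the left: there are `C > 0` and a neighbourhood `U` of `1 ∈ G` such that
`C⁻¹ ‖φ(u) - φ(1)‖ ≤ d_{G/Γ}(uyΓ, yΓ) ≤ C ‖φ(u) - φ(1)‖` for all `u ∈ U` and all `y ∈ G`, where `φ`
is the preferred chart of `G` at `1` (any smooth chart at `1` gives the same class, charts being
smoothly compatible). This is the class of metrics of the source ("we shall arbitrarily endow each
nilmanifold `G/Γ` with a smooth Riemannian metric `d_{G/Γ}`"; "if one replaces the metric with
another smooth Riemannian metric then from the compactness of `G/Γ` we see that the Lipschitz
constant is only affected by at most a multiplicative constant", Def. 8.1 and the Remark after it;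
"`G/Γ = (G/Γ, d_{G/Γ})` … with some fixed smooth metric" in Conj. 8.3, Prop. 8.2, Conj. 8.5): a
smooth Riemannian metric on the compact manifold `G/Γ`, or the right-invariant Mal'cev-basis metrics
`d_𝒳` of Green–Tao (2012) and Green–Tao–Ziegler (2012), satisfies it (locally
`d_{G/Γ}(uyΓ, yΓ) = d_G(u, 1) ≍ |ψ(u)|` uniformly in `y`, by right-invariance, discreteness of `Γ`
and compactness of a fundamental domain), and conversely a compatible metric in this class is
bi-Lipschitz to any of those on the compact quotient, so that Lipschitz classes — and with them
`GI(s)` and `MN(s)` — are the same up to constants. The tree's `Nilmanifold` allows arbitrary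
compatible metrics; `GI(s)` and `MN(s)` are to be read for this class
(`MetricPathology.not_isSmoothlyMetrised_badCircle`, `MetricPathology.not_MNAt_badCircle`).
[cite: GreenTao2010, Def. 8.1 (and the Remark following it), Conj. 8.3, Conj. 8.5] -/
def IsSmoothlyMetrised (X : Nilmanifold s) : Prop :=
  ∃ C : ℝ, 0 < C ∧ ∀ᶠ u in 𝓝 (1 : X.G), ∀ y : X.G,
    ‖chartAt X.E (1 : X.G) u - chartAt X.E (1 : X.G) 1‖ ≤
        C * X.dist (QuotientGroup.mk (u * y)) (QuotientGroup.mk y) ∧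
      X.dist (QuotientGroup.mk (u * y)) (QuotientGroup.mk y) ≤
        C * ‖chartAt X.E (1 : X.G) u - chartAt X.E (1 : X.G) 1‖

/-- Raising the step does not change the metric class. [folklore] -/
theorem isSmoothlyMetrised_ofLE_iff {s' : ℕ} (X : Nilmanifold s) (h : s ≤ s') :
    (X.ofLE h).IsSmoothlyMetrised ↔ X.IsSmoothlyMetrised := Iff.rfl

/-- The one-point nilmanifold is smoothly metrised (everything vanishes). [folklore] -/
theorem isSmoothlyMetrised_point (s : ℕ) : (point s).IsSmoothlyMetrised := by
  refine ⟨1, one_pos, Filter.Eventually.of_forall fun u y => ?_⟩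
  have h0 : chartAt (point s).E (1 : (point s).G) u - chartAt (point s).E (1 : (point s).G) 1 = 0 :=
    Subsingleton.elim (α := Fin 0 → ℝ) _ _
  have hd : (point s).dist (QuotientGroup.mk (u * y)) (QuotientGroup.mk y) = 0 := rfl
  rw [h0, hd, norm_zero, mul_zero]
  exact ⟨le_rfl, le_rfl⟩

/-- The element `r` of the Lie group `ℝ` of the circle nilmanifold (written multiplicatively).
[folklore] -/
def circleElt (r : ℝ) : circle.G := Multiplicative.ofAdd r

/-- `r · s = r + s` in the Lie group of the circle nilmanifold. [folklore] -/
theorem circleElt_mul (r r' : ℝ) : circleElt r * circleElt r' = circleElt (r + r') := rfl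

/-- Every element of the Lie group of the circle nilmanifold is some `circleElt r`. [folklore] -/
theorem exists_eq_circleElt (y : circle.G) : ∃ r : ℝ, y = circleElt r :=
  ⟨Multiplicative.toAdd (y : Multiplicative ℝ), rfl⟩

/-- The coset of `circleElt r` is the point `r + ℤ`. [folklore] -/
theorem mk_circleElt (r : ℝ) : (QuotientGroup.mk (circleElt r) : circle.G ⧸ circle.Γ) = circlePt r :=
  rfl

/-- **The circle `ℝ/ℤ` with its usual metric is smoothly metrised** (`d(u + y + ℤ, y + ℤ) = |u|` for
`|u| < 1/2`). [folklore] -/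
theorem isSmoothlyMetrised_circle : circle.IsSmoothlyMetrised := by
  refine ⟨1, one_pos, ?_⟩
  have key : ∀ u₀ : ℝ, |u₀| < 1 / 2 → ∀ y : circle.G,
      ‖chartAt circle.E (1 : circle.G) (circleElt u₀) - chartAt circle.E (1 : circle.G) 1‖ ≤
          1 * circle.dist (QuotientGroup.mk (circleElt u₀ * y)) (QuotientGroup.mk y) ∧
        circle.dist (QuotientGroup.mk (circleElt u₀ * y)) (QuotientGroup.mk y) ≤
          1 * ‖chartAt circle.E (1 : circle.G) (circleElt u₀) - chartAt circle.E (1 : circle.G) 1‖ := by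
    intro u₀ hu₀ y
    obtain ⟨y₀, hy⟩ := exists_eq_circleElt y
    rw [hy]
    have hdist : circle.dist (QuotientGroup.mk (circleElt u₀ * circleElt y₀))
        (QuotientGroup.mk (circleElt y₀)) = |u₀| := by
      rw [circleElt_mul, mk_circleElt, mk_circleElt, circle_dist_circlePt, add_sub_cancel_right,
        round_eq_zero_iff.2 ⟨by linarith [(abs_lt.1 hu₀).1], (abs_lt.1 hu₀).2⟩, Int.cast_zero,
        sub_zero]
    have hchart : ‖chartAt circle.E (1 : circle.G) (circleElt u₀) -
        chartAt circle.E (1 : circle.G) 1‖ = |u₀| := by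
      show ‖(u₀ : ℝ) - 0‖ = |u₀|
      rw [sub_zero, Real.norm_eq_abs]
    rw [hchart, hdist, one_mul]
    exact ⟨le_rfl, le_rfl⟩
  have hev : ∀ᶠ u₀ in 𝓝 (0 : ℝ), |u₀| < 1 / 2 :=
    Metric.eventually_nhds_iff.2 ⟨1 / 2, by norm_num, fun u hu => by simpa [Real.dist_eq] using hu⟩
  exact hev.mono fun u₀ hu₀ => key u₀ hu₀

/-- **Products of smoothly metrised nilmanifolds are smoothly metrised** (max metric, product
chart). [folklore] -/
theorem isSmoothlyMetrised_prod {X Y : Nilmanifold s} (hX : X.IsSmoothlyMetrised)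
    (hY : Y.IsSmoothlyMetrised) : (X.prod Y).IsSmoothlyMetrised := by
  obtain ⟨C₁, hC₁, h₁⟩ := hX
  obtain ⟨C₂, hC₂, h₂⟩ := hY
  refine ⟨max C₁ C₂, lt_max_of_lt_left hC₁, ?_⟩
  have h12 : ∀ᶠ p : X.G × Y.G in 𝓝 (1 : X.G × Y.G),
      (∀ y : X.G, ‖chartAt X.E (1 : X.G) p.1 - chartAt X.E (1 : X.G) 1‖ ≤
          C₁ * X.dist (QuotientGroup.mk (p.1 * y)) (QuotientGroup.mk y) ∧
        X.dist (QuotientGroup.mk (p.1 * y)) (QuotientGroup.mk y) ≤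
          C₁ * ‖chartAt X.E (1 : X.G) p.1 - chartAt X.E (1 : X.G) 1‖) ∧
      (∀ y : Y.G, ‖chartAt Y.E (1 : Y.G) p.2 - chartAt Y.E (1 : Y.G) 1‖ ≤
          C₂ * Y.dist (QuotientGroup.mk (p.2 * y)) (QuotientGroup.mk y) ∧
        Y.dist (QuotientGroup.mk (p.2 * y)) (QuotientGroup.mk y) ≤
          C₂ * ‖chartAt Y.E (1 : Y.G) p.2 - chartAt Y.E (1 : Y.G) 1‖) := by
    rw [show (1 : X.G × Y.G) = ((1 : X.G), (1 : Y.G)) from rfl, nhds_prod_eq]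
    exact h₁.prod_mk h₂
  change ∀ᶠ p : X.G × Y.G in 𝓝 (1 : X.G × Y.G), ∀ q : X.G × Y.G, _
  refine h12.mono fun p hp q => ?_
  obtain ⟨hp1, hp2⟩ := hp
  obtain ⟨ha1, hb1⟩ := hp1 q.1
  obtain ⟨ha2, hb2⟩ := hp2 q.2
  show ‖((chartAt X.E (1 : X.G) p.1, chartAt Y.E (1 : Y.G) p.2) : X.E × Y.E) -
        (chartAt X.E (1 : X.G) 1, chartAt Y.E (1 : Y.G) 1)‖ ≤
      max C₁ C₂ * max (X.dist (QuotientGroup.mk (p.1 * q.1)) (QuotientGroup.mk q.1))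
        (Y.dist (QuotientGroup.mk (p.2 * q.2)) (QuotientGroup.mk q.2)) ∧
    max (X.dist (QuotientGroup.mk (p.1 * q.1)) (QuotientGroup.mk q.1))
        (Y.dist (QuotientGroup.mk (p.2 * q.2)) (QuotientGroup.mk q.2)) ≤
      max C₁ C₂ * ‖((chartAt X.E (1 : X.G) p.1, chartAt Y.E (1 : Y.G) p.2) : X.E × Y.E) -
        (chartAt X.E (1 : X.G) 1, chartAt Y.E (1 : Y.G) 1)‖
  rw [Prod.mk_sub_mk, Prod.norm_mk]
  have hC1 : C₁ ≤ max C₁ C₂ := le_max_left _ _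
  have hC2 : C₂ ≤ max C₁ C₂ := le_max_right _ _
  have hd1 := X.dist_nonneg (QuotientGroup.mk (p.1 * q.1)) (QuotientGroup.mk q.1)
  have hd2 := Y.dist_nonneg (QuotientGroup.mk (p.2 * q.2)) (QuotientGroup.mk q.2)
  constructor
  · refine max_le ?_ ?_
    · exact ha1.trans ((mul_le_mul_of_nonneg_right hC1 hd1).trans
        (mul_le_mul_of_nonneg_left (le_max_left _ _) (hC₁.le.trans hC1)))
    · exact ha2.trans ((mul_le_mul_of_nonneg_right hC2 hd2).trans
        (mul_le_mul_of_nonneg_left (le_max_right _ _) (hC₁.le.trans hC1)))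
  · refine max_le ?_ ?_
    · exact hb1.trans ((mul_le_mul_of_nonneg_right hC1 (norm_nonneg _)).trans
        (mul_le_mul_of_nonneg_left (le_max_left _ _) (hC₁.le.trans hC1)))
    · exact hb2.trans ((mul_le_mul_of_nonneg_right hC2 (norm_nonneg _)).trans
        (mul_le_mul_of_nonneg_left (le_max_right _ _) (hC₁.le.trans hC1)))

/-- Powers of a smoothly metrised nilmanifold are smoothly metrised. [folklore] -/
theorem isSmoothlyMetrised_pow {X : Nilmanifold s} (hX : X.IsSmoothlyMetrised) :
    ∀ m : ℕ, (X.pow m).IsSmoothlyMetrised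
  | 0 => isSmoothlyMetrised_point s
  | m + 1 => isSmoothlyMetrised_prod hX (isSmoothlyMetrised_pow hX m)

/-- The nilmanifolds `X^m × ℝ/ℤ` of §12 are smoothly metrised when `X` is. [folklore] -/
theorem isSmoothlyMetrised_pow_prod_circle {X : Nilmanifold s} (hX : X.IsSmoothlyMetrised)
    (hs : 1 ≤ s) (m : ℕ) : ((X.pow m).prod (circle.ofLE hs)).IsSmoothlyMetrised :=
  isSmoothlyMetrised_prod (isSmoothlyMetrised_pow hX m)
    ((isSmoothlyMetrised_ofLE_iff circle hs).2 isSmoothlyMetrised_circle)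

end Nilmanifold

end Literature.NumberTheory.Sieve

namespace Literature.NumberTheory.Sieve

namespace MetricPathology

open Nilmanifold

/-! ### `badCircle` is not smoothly metrised -/

/-- The element `r` of the Lie group `ℝ` of `badCircle` (written multiplicatively). [folklore] -/
def badElt (r : ℝ) : badCircle.G := Multiplicative.ofAdd r

/-- `r · r' = r + r'` in the Lie group of `badCircle`. [folklore] -/
theorem badElt_mul (r r' : ℝ) : badElt r * badElt r' = badElt (r + r') := rfl

/-- The coset of `badElt r` is the point `r + ℤ`. [folklore] -/
theorem badCircle_dist_mk_badElt (a b : ℝ) :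
    badCircle.dist (QuotientGroup.mk (badElt a)) (QuotientGroup.mk (badElt b)) = pathDist (pt a) (pt b) :=
  rfl

/-- `F_N(1/N) = ε_N` (`μ(1) = 1`) for `N ≥ 2`. [folklore] -/
theorem pathF_pt_one_div {N : ℕ} (hN : 2 ≤ N) : pathF N (pt (1 / (N : ℝ))) = eps N := by
  have h := bumpSum_pt (N := N) (n := 1) (by omega) le_rfl (by omega)
  rw [Nat.cast_one, if_pos (by omega), ArithmeticFunction.moebius_apply_one, Int.cast_one] at h
  unfold pathF
  rw [h, clamp_eq_self (by norm_num), mul_one]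

/-- `F_N(0) = 0` for `N ≥ 1`. [folklore] -/
theorem pathF_pt_zero {N : ℕ} (hN : 1 ≤ N) : pathF N (pt 0) = 0 := by
  have h := bumpSum_pt (N := N) (n := N) (by omega) hN le_rfl
  rw [if_neg (by omega)] at h
  have hN0 : (N : ℝ) ≠ 0 := by exact_mod_cast (show N ≠ 0 by omega)
  have e : pt ((N : ℝ) / N) = pt 0 := by
    unfold pt
    rw [div_self hN0, AddCircle.coe_period, QuotientAddGroup.mk_zero]
  unfold pathF
  rw [← e, h]
  simp [clamp]

/-- **`badCircle` is not smoothly metrised**: `d'((-1/N + 1/N) + ℤ, 1/N + ℤ) ≥ |F_N(0) - F_N(1/N)|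
= ε_N = 1/(log N + 2)`, which is not `O(1/N)`. So the failure of `MN(1)` on `badCircle`
(`not_MNAt_badCircle`) is a failure of the metric class, consistent with Conj. 8.5 for smooth
metrics. (compare Green–Tao 2010, Conj. 8.5) [folklore] -/
theorem not_isSmoothlyMetrised_badCircle : ¬badCircle.IsSmoothlyMetrised := by
  rintro ⟨C, hC, hev⟩
  have hev' : ∀ᶠ u₀ in 𝓝 (0 : ℝ), ∀ y : badCircle.G,
      ‖chartAt badCircle.E (1 : badCircle.G) (badElt u₀) - chartAt badCircle.E (1 : badCircle.G) 1‖ ≤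
          C * badCircle.dist (QuotientGroup.mk (badElt u₀ * y)) (QuotientGroup.mk y) ∧
        badCircle.dist (QuotientGroup.mk (badElt u₀ * y)) (QuotientGroup.mk y) ≤
          C * ‖chartAt badCircle.E (1 : badCircle.G) (badElt u₀) -
            chartAt badCircle.E (1 : badCircle.G) 1‖ :=
    hev
  obtain ⟨ε, hε, hball⟩ := Metric.eventually_nhds_iff.1 hev'
  -- a large `N`: `1/N < ε` and `N > C (log N + 2)`
  set t : ℝ := 3 * C + 3 + 1 / ε with ht
  have hε' : 0 < 1 / ε := by positivity
  have ht0 : 0 ≤ t := by positivity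
  set N : ℕ := ⌈Real.exp t⌉₊ with hNdef
  have hNexp : Real.exp t ≤ N := Nat.le_ceil _
  have hquad : 1 + t + t ^ 2 / 2 ≤ Real.exp t := Real.quadratic_le_exp_of_nonneg ht0
  have hN4 : (4 : ℝ) ≤ N := by nlinarith [sq_nonneg t]
  have hN2 : 2 ≤ N := by exact_mod_cast (show (2 : ℝ) ≤ N by linarith)
  have hN0 : (0 : ℝ) < N := by linarith
  have hNε : 1 / (N : ℝ) < ε := by
    rw [one_div_lt hN0 hε]
    nlinarith [sq_nonneg t]
  have hlogN : Real.log N < t + 1 := by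
    have hNlt : (N : ℝ) < Real.exp t + 1 := Nat.ceil_lt_add_one (Real.exp_pos t).le
    have h1' : ∀ x : ℝ, 0 ≤ x → Real.exp x + 1 ≤ Real.exp (x + 1) := fun x hx => by
      rw [Real.exp_add]
      nlinarith [Real.add_one_le_exp (1 : ℝ), Real.one_le_exp hx, Real.exp_pos x]
    have h1 := h1' t ht0
    calc Real.log N < Real.log (Real.exp (t + 1)) :=
          Real.log_lt_log hN0 (hNlt.trans_le h1)
      _ = t + 1 := Real.log_exp _
  -- the two test points `u = -1/N`, `y = 1/N`
  have hdist0 : Dist.dist (-(1 / (N : ℝ))) (0 : ℝ) < ε := by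
    rw [Real.dist_eq, sub_zero, abs_neg, abs_of_pos (by positivity)]
    exact hNε
  have key := (hball hdist0 (badElt (1 / (N : ℝ)))).2
  have hchart : ‖chartAt badCircle.E (1 : badCircle.G) (badElt (-(1 / (N : ℝ)))) -
      chartAt badCircle.E (1 : badCircle.G) 1‖ = 1 / N := by
    show ‖(-(1 / (N : ℝ)) : ℝ) - 0‖ = 1 / N
    rw [sub_zero, norm_neg, Real.norm_eq_abs, abs_of_pos (by positivity)]
  have hlow : eps N ≤ badCircle.dist (QuotientGroup.mk (badElt (-(1 / (N : ℝ))) * badElt (1 / (N : ℝ))))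
      (QuotientGroup.mk (badElt (1 / (N : ℝ)))) := by
    rw [badElt_mul, neg_add_cancel, badCircle_dist_mk_badElt]
    calc eps N = |pathF N (pt 0) - pathF N (pt (1 / (N : ℝ)))| := by
          rw [pathF_pt_zero (by omega), pathF_pt_one_div hN2, zero_sub, abs_neg,
            abs_of_pos (eps_pos N)]
      _ ≤ oscDist (pt 0) (pt (1 / (N : ℝ))) := abs_sub_le_oscDist N _ _
      _ ≤ pathDist (pt 0) (pt (1 / (N : ℝ))) := le_add_of_nonneg_left (norm_nonneg _)
  rw [hchart] at key
  have hfin : eps N ≤ C * (1 / N) := hlow.trans key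
  -- `1/(log N + 2) ≤ C/N` forces `N ≤ C (log N + 2) < C (t + 3)`, contradicting `N ≥ exp t`
  unfold eps at hfin
  have hL2 : 0 < Real.log N + 2 := by have := Real.log_natCast_nonneg N; linarith
  rw [mul_one_div, div_le_div_iff₀ hL2 hN0, one_mul] at hfin
  have h1 : (N : ℝ) < C * (t + 3) := by nlinarith
  have h2 : (3 * C + 3) * t ≤ t ^ 2 := by
    rw [sq]; exact mul_le_mul_of_nonneg_right (by linarith) ht0
  nlinarith

end MetricPathology

end Literature.NumberTheory.Sieve

namespace Literature.NumberTheory.Sieve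

/-! ### Thm. 7.2 relative to a class of nilmanifolds, and for the smooth class

The nilmanifold-side inputs of Thm. 7.2 — Lemma E.9 (rationality of `Γ ∩ G_j`), divisibility of
`G`, and `MN(s)` — are only ever applied, in §§10–12, to the finitely many members `G/Γ ∈ ℳ_{s,δ}` of
the inverse families of `GI(s)` and to the product nilmanifolds `(G/Γ)^m × ℝ/ℤ` formed from them in
§12. The assemblies below record exactly this, first relative to an arbitrary class `𝒞` of `s`-step
nilmanifolds containing the inverse families, then for the class of smoothly metrised nilmanifolds
(`Nilmanifold.IsSmoothlyMetrised`, closed under the products used and containing `ℝ/ℤ`), for which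
the hypotheses are the printed `GI(s)` (families "with some fixed smooth metric") and the printed
`MN(s)` ("nilmanifold with smooth metric") — as opposed to "`MN(s)` for every `Y : Nilmanifold s`",
which is false (`MetricPathology.not_forall_MNAt`). The sharp estimate (12.6) is kept as a
hypothesis here; it is discharged in `LinearEquationsInPrimesSharpUniform.lean`. -/

/-- **Thm. 7.2 at level `s ≥ 1` from a `GI(s)` datum whose nilmanifolds are rational, divisible and
satisfy `MN(s)` on their powers times the circle, and the sharp estimate (12.6)** — the form of the
reduction in which every nilmanifold-side hypothesis is asked only of the finitely many members
`G/Γ ∈ ℳ_{s,δ}` of the inverse family (and of the product nilmanifolds `(G/Γ)^m × ℝ/ℤ` built from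
them in §12), exactly as the hypotheses are used in the source: Prop. 10.1 ⇐ `GI(s)` + Cor. 11.6 for
the members (§10); Prop. 10.2 for the members ⇐ (12.6) + (12.7) (§§11–12); (12.7) for a member
⇐ `MN(s)` on its powers times `ℝ/ℤ` + divisibility (§12). [cite: GreenTao2010, Thm. 7.2, §10
(proof of Thm. 7.2), §§11–12, Conj. 8.3, Conj. 8.5] -/
theorem GreenTao2010_gowersUniformityAt_of_datum_of_MN_of_sharp {s : ℕ} (hs : 1 ≤ s)
    (hGI : ∀ δ : ℝ, 0 < δ → δ ≤ 1 → ∃ (m : ℕ) (𝓜 : Fin m → Nilmanifold s) (MG cG : ℝ),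
      GreenTao2010_inverseDatum s δ 𝓜 MG cG ∧ ∀ i, (𝓜 i).IsRational ∧ (𝓜 i).IsDivisible ∧
        ∀ (m' : ℕ) (M : ℝ),
          GreenTao2010_MNAt s (((𝓜 i).pow m').prod (Nilmanifold.circle.ofLE hs)) M)
    {χ : ℝ → ℝ} {Lχ γ : ℝ} (hχ0 : ∀ x, 0 ≤ x → x ≤ 1 / 2 → χ x = x)
    (hχL : ∀ x y, |χ x - χ y| ≤ Lχ * |x - y|) (hLχ : 0 ≤ Lχ) (hγ : 0 < γ)
    (hSharp : GreenTao2010_sharpUniformAt s χ fun N => (N : ℝ) ^ γ) :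
    GreenTao2010_gowersUniformityAt s := by
  refine GreenTao2010_gowersUniformityAt_of_local hs GreenTao2010_pseudorandomDomination_holds
    fun δ hδ hδ1 C hC A => ?_
  have hC1 : (1 : ℝ) ≤ C := by linarith
  obtain ⟨m, 𝓜, MG, cG, hd, hgood⟩ := hGI (relInvParam s C δ) (relInvParam_pos s (by linarith) hδ)
    (relInvParam_le_one s hC1 hδ1)
  obtain ⟨η, hdat⟩ := GreenTao2010_relativeInverseDatum_of_inverseDatum hs hδ hC A hd fun i =>
    GreenTao2010_nilObstructionAt_of_isRational (𝓜 i) (hgood i).1 MG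
  exact ⟨m, 𝓜, MG, cG / 2, η, 1, hdat, fun i =>
    GreenTao2010_nilsequenceOrthogonalityAt_of_sharp_of_flat (𝓜 i) (hgood i).1 MG χ _
      (eventually_log_rpow_ne_zero hγ) hSharp
      (GreenTao2010_flatOrthogonalAt_of_MN hs (𝓜 i) (hgood i).2.1 hχ0 hχL hLχ hγ
        fun m' M => (hgood i).2.2 m' M)⟩

/-- **Thm. 7.2 at level `s ≥ 1` relative to a class `𝒞` of `s`-step nilmanifolds, given (12.6)**: if
`GI(s)` holds with inverse families drawn from `𝒞`, and the members of `𝒞` are rational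
(Lemma E.9), divisible, and satisfy `MN(s)` on their powers times `ℝ/ℤ`, then (12.6) implies Thm. 7.2
at level `s`. [cite: GreenTao2010, Thm. 7.2, §§10–12, Conj. 8.3, Conj. 8.5] -/
theorem GreenTao2010_gowersUniformityAt_of_class_of_sharp {s : ℕ} (hs : 1 ≤ s)
    (𝒞 : Set (Nilmanifold s)) (hrat : ∀ X ∈ 𝒞, X.IsRational) (hdiv : ∀ X ∈ 𝒞, X.IsDivisible)
    (hGI : ∀ δ : ℝ, 0 < δ → δ ≤ 1 → ∃ (m : ℕ) (𝓜 : Fin m → Nilmanifold s) (MG cG : ℝ),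
      (∀ i, 𝓜 i ∈ 𝒞) ∧ GreenTao2010_inverseDatum s δ 𝓜 MG cG)
    (hMN : ∀ X ∈ 𝒞, ∀ (m : ℕ) (M : ℝ),
      GreenTao2010_MNAt s ((X.pow m).prod (Nilmanifold.circle.ofLE hs)) M)
    {χ : ℝ → ℝ} {Lχ γ : ℝ} (hχ0 : ∀ x, 0 ≤ x → x ≤ 1 / 2 → χ x = x)
    (hχL : ∀ x y, |χ x - χ y| ≤ Lχ * |x - y|) (hLχ : 0 ≤ Lχ) (hγ : 0 < γ)
    (hSharp : GreenTao2010_sharpUniformAt s χ fun N => (N : ℝ) ^ γ) :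
    GreenTao2010_gowersUniformityAt s :=
  GreenTao2010_gowersUniformityAt_of_datum_of_MN_of_sharp hs
    (fun δ hδ hδ1 => by
      obtain ⟨m, 𝓜, MG, cG, hmem, hd⟩ := hGI δ hδ hδ1
      exact ⟨m, 𝓜, MG, cG, hd, fun i => ⟨hrat _ (hmem i), hdiv _ (hmem i),
        fun m' M => hMN _ (hmem i) m' M⟩⟩)
    hχ0 hχL hLχ hγ hSharp

/-- **Thm. 7.2 at level `s ≥ 1` for smoothly metrised nilmanifolds, given (12.6)**: `GI(s)` as
printed (an inverse family of smoothly metrised nilmanifolds), Lemma E.9 and divisibility for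
smoothly metrised nilmanifolds, and `MN(s)` as printed (for smoothly metrised nilmanifolds), imply,
with (12.6), Thm. 7.2 at level `s` — `MN(s)` being applied to the smoothly metrised products
`X^m × ℝ/ℤ` (`Nilmanifold.isSmoothlyMetrised_pow_prod_circle`).
[cite: GreenTao2010, Thm. 7.2, §§10–12, Conj. 8.3, Conj. 8.5] -/
theorem GreenTao2010_gowersUniformityAt_of_smooth_of_sharp {s : ℕ} (hs : 1 ≤ s)
    (hrat : ∀ X : Nilmanifold s, X.IsSmoothlyMetrised → X.IsRational)
    (hdiv : ∀ X : Nilmanifold s, X.IsSmoothlyMetrised → X.IsDivisible)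
    (hGI : ∀ δ : ℝ, 0 < δ → δ ≤ 1 → ∃ (m : ℕ) (𝓜 : Fin m → Nilmanifold s) (MG cG : ℝ),
      (∀ i, (𝓜 i).IsSmoothlyMetrised) ∧ GreenTao2010_inverseDatum s δ 𝓜 MG cG)
    (hMN : ∀ Y : Nilmanifold s, Y.IsSmoothlyMetrised → ∀ M : ℝ, GreenTao2010_MNAt s Y M)
    {χ : ℝ → ℝ} {Lχ γ : ℝ} (hχ0 : ∀ x, 0 ≤ x → x ≤ 1 / 2 → χ x = x)
    (hχL : ∀ x y, |χ x - χ y| ≤ Lχ * |x - y|) (hLχ : 0 ≤ Lχ) (hγ : 0 < γ)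
    (hSharp : GreenTao2010_sharpUniformAt s χ fun N => (N : ℝ) ^ γ) :
    GreenTao2010_gowersUniformityAt s :=
  GreenTao2010_gowersUniformityAt_of_class_of_sharp hs {X | X.IsSmoothlyMetrised} hrat hdiv hGI
    (fun _ hX m M => hMN _ (Nilmanifold.isSmoothlyMetrised_pow_prod_circle hX hs m) M)
    hχ0 hχL hLχ hγ hSharp

/-- **`GreenTao2010_gowersUniformity` (Thm. 7.2, all `s`) from the printed inputs for smoothly
metrised nilmanifolds and (12.6)**: `GI(s)` with smoothly metrised inverse families, Lemma E.9 and
divisibility, `MN(s)` for smoothly metrised nilmanifolds, and, at each level, some admissible cutoff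
with the sharp estimate (12.6). [cite: GreenTao2010, Thm. 7.2, §§10–12, Conj. 8.3, Conj. 8.5, App. D]
[cite: GreenTaoZiegler2012, Thm. 1.3] [cite: GreenTao2012Mobius, Thm. 1.1] -/
theorem GreenTao2010_gowersUniformity_of_smooth_GI_of_MN_of_sharp
    (hrat : ∀ (s : ℕ) (X : Nilmanifold s), X.IsSmoothlyMetrised → X.IsRational)
    (hdiv : ∀ (s : ℕ) (X : Nilmanifold s), X.IsSmoothlyMetrised → X.IsDivisible)
    (hGI : ∀ s : ℕ, 1 ≤ s → ∀ δ : ℝ, 0 < δ → δ ≤ 1 →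
      ∃ (m : ℕ) (𝓜 : Fin m → Nilmanifold s) (MG cG : ℝ),
        (∀ i, (𝓜 i).IsSmoothlyMetrised) ∧ GreenTao2010_inverseDatum s δ 𝓜 MG cG)
    (hMN : ∀ s : ℕ, 1 ≤ s → ∀ Y : Nilmanifold s, Y.IsSmoothlyMetrised → ∀ M : ℝ,
      GreenTao2010_MNAt s Y M)
    (hSharp : ∀ s : ℕ, 1 ≤ s → ∃ (χ : ℝ → ℝ) (Lχ γ : ℝ),
      (∀ x, 0 ≤ x → x ≤ 1 / 2 → χ x = x) ∧ (∀ x y, |χ x - χ y| ≤ Lχ * |x - y|) ∧ 0 ≤ Lχ ∧ 0 < γ ∧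
        GreenTao2010_sharpUniformAt s χ fun N => (N : ℝ) ^ γ) :
    GreenTao2010_gowersUniformity :=
  GreenTao2010_gowersUniformity_iff.mpr fun s hs => by
    obtain ⟨χ, Lχ, γ, hχ0, hχL, hLχ, hγ, hS⟩ := hSharp s hs
    exact GreenTao2010_gowersUniformityAt_of_smooth_of_sharp hs (hrat s) (hdiv s) (hGI s hs)
      (hMN s hs) hχ0 hχL hLχ hγ hS

end Literature.NumberTheory.Sieve
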